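import Summits.AnomalousDissipation.AnomalousDissipation.Theses.WazewskiBlock
import Summits.AnomalousDissipation.AnomalousDissipation.Theorems.WazewskiBlockPlanarGalerkinNoTrapCoeffODE
import Literature.Analysis.FluidPDE.GalerkinFlow
import Literature.Analysis.FluidPDE.NSGalerkinTrajectory
import Literature.Analysis.FunctionSpaces.TorusFourierModes
import Literature.Analysis.FunctionSpaces.TorusFourierCalculus
import Literature.Analysis.FunctionSpaces.TorusFluidGlue
import Literature.Analysis.FunctionSpaces.TorusSpaceTimeFields

/-!
# Route `WazewskiBlock`, crux `UniformWorkFloorTrap` (stmt-AnomalousDissipation-10353):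
# the load-bearing facts every witness obeys, and the crux in semiflow language

Definition-free support file of the line `Sketch` (lead c1).  The crux asks for a mean-zero
Galerkin-mode force `f`, constants `E, ε₀, ν₀ > 0` and, for every `0 < ν ≤ ν₀` and every large
order `N ≥ N₀(ν)`, a global Galerkin trajectory `U` of order `N` trapped for all `t ≥ 0` in the
block `B = {kineticEnergy ≤ E} ∩ {(f, ·) ≥ ε₀}`.  Kernel-checked here:

* `continuousOn_work` — the work `t ↦ ∫⟪f, U t⟫` is continuous on `[0, ∞)`;
* `dissipation_floor_of_trapped` — **the crux implies the Galerkin-level zeroth law along its own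
  orbits**: a trapped trajectory dissipates `ν ∫₀ᵀ ‖∇U‖² ≥ ε₀ T − E` for every `T ≥ 0` (exact
  energy identity, `KE ≥ 0`, `KE ≤ E`, `W ≥ ε₀`), uniformly in `ν ≤ ν₀` and `N ≥ N₀(ν)`;
* `eGradNormSq_le_of_isGalerkinMode` — Bernstein: a Galerkin mode of order `N` has
  `‖∇a‖² ≤ 8π² N² · kineticEnergy a`;
* `resolution_floor_of_trapped` — hence a trapped trajectory of order `N` at viscosity `ν ≥ 0`
  forces `ε₀ ≤ 8π² ν N² E`: the crux's threshold obeys `N₀(ν)² ≥ ε₀ / (8π² ν E) → ∞` as `ν → 0`,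
  and `not_uniformWorkFloorTrap_fixedResolution` — the natural strengthening "one resolution
  `N₀` for all `ν ≤ ν₀`" of the crux is FALSE for every force;
* `uniformWorkFloorTrap_iff_orbit` — **the crux ⇔ its orbit form**: for every `0 < ν ≤ ν₀` and
  `N ≥ N₀(ν)` some Galerkin mode `a` of order `N` has its `Torus.galerkinFlow ν f N` orbit in `B`
  for all `t ≥ 0` (⇐ `IsGalerkinMode.galerkinFlow_clauses`; ⇒ the clause block determines the
  orbit — uniqueness for the Galerkin ODE, as in the sibling file
  `WazewskiBlockUniformGalerkinTrapLandingEquivalence.lean`).  Disjunct (ii) of the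
  line's core stub `stub_loudGalerkinFamily` is therefore NECESSARY as well as sufficient: the core
  stub is the crux in semiflow language, not a weakening of it;
* `uniformWorkFloorTrap_dissipationFloor` — the crux implies the family-level dissipation floor
  (`∀ ν ≤ ν₀ ∃ N₀ ∀ N ≥ N₀ ∃` bounded-energy Galerkin trajectory with `ν∫₀ᵀ‖∇U‖² ≥ ε₀T − E ∀ T`).

References: Robinson–Rodrigo–Sadowski 2016, §4.1, Thm. 4.4 Steps 1–2 (Galerkin system, energy
identity, uniqueness); Constantin–Foias 1988, Ch. 8 (8.5)–(8.7); Doering–Foias 2002 §2 (energy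
dissipation bookkeeping); the sibling negative file
`Theorems/TaylorGreenLoudGalerkinStates/Negative/LoadBearing.lean` (`resolution_floor` for steady states).
-/

noncomputable section

-- `Summit.<Summit>.<Problem>` is the tree's mandated summit-side namespace (CONVENTIONS §2); deliberate duplicate.
set_option linter.dupNamespace false

namespace Summit.AnomalousDissipation.AnomalousDissipation.Theorems.UniformWorkFloorTrap

open scoped InnerProductSpace ENNReal
open MeasureTheory Filter Set UnitAddTorus
open Literature.Analysis.FunctionSpaces Literature.Analysis.FunctionSpaces.Torus
open Literature.Analysis.FluidPDE
open Summit.AnomalousDissipation.AnomalousDissipation.Theses.WazewskiBlock (UniformWorkFloorTrap)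
open Summit.AnomalousDissipation.AnomalousDissipation.Theorems.WazewskiBlock.PlanarGalerkinNoTrap
  (isGalerkinTrajectory_coeff)

variable {ν : ℝ} {N : ℕ} {f : UnitAddTorus (Fin 3) → EuclideanSpace ℝ (Fin 3)}
  {U : ℝ → UnitAddTorus (Fin 3) → EuclideanSpace ℝ (Fin 3)}

/-! ## §1 The work is continuous in time -/

/-- **The work is continuous in time** on `[0, ∞)` along a Galerkin trajectory with a continuous
force: the space–time lift of `(τ, x) ↦ ⟪f x, U τ x⟫` is continuous on `[0, ∞) × ℝ³` (joint
continuity of `U`), so `Torus.continuousOn_integral_of_continuousOn_stLift` applies. [folklore] -/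
theorem continuousOn_work (hf : Continuous f) (hU : Torus.IsGalerkinTrajectory ν f N U) :
    ContinuousOn (fun τ => ∫ x, ⟪f x, U τ x⟫_ℝ) (Ici 0) := by
  refine continuousOn_integral_of_continuousOn_stLift (u := fun τ x => ⟪f x, U τ x⟫_ℝ) ?_
  have hL : Continuous fun q : ℝ × EuclideanSpace ℝ (Fin 3) => f (proj q.2) :=
    (hf.comp continuous_proj).comp continuous_snd
  have h : (stLift fun τ x => ⟪f x, U τ x⟫_ℝ) = fun q => ⟪f (proj q.2), stLift U q⟫_ℝ := by
    funext q
    obtain ⟨τ, y⟩ := q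
    simp only [stLift_apply]
  rw [h]
  exact hL.continuousOn.inner hU.continuousOn

/-! ## §2 The dissipation floor of a trapped trajectory -/

/-- **A trapped trajectory dissipates at rate `≥ ε₀` on average** (the crux implies the
Galerkin-level zeroth law along its own orbits): if a Galerkin trajectory `U` of order `N` stays in
`{kineticEnergy ≤ E} ∩ {(f, ·) ≥ ε₀}` for all `t ≥ 0` (force continuous), then
`ε₀ T − E ≤ ν ∫₀ᵀ ‖∇U‖²` for every `T ≥ 0` — the exact energy identity
`KE(T) + ν∫₀ᵀ‖∇U‖² = KE(0) + ∫₀ᵀ W` with `KE(0) ≥ 0`, `KE(T) ≤ E`, `W ≥ ε₀`. [folklore] -/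
theorem dissipation_floor_of_trapped {E ε₀ T : ℝ} (hf : Continuous f)
    (hU : Torus.IsGalerkinTrajectory ν f N U)
    (htrap : ∀ t : ℝ, 0 ≤ t → kineticEnergy (U t) ≤ E ∧ ε₀ ≤ ∫ x, ⟪f x, U t x⟫_ℝ) (hT : 0 ≤ T) :
    ε₀ * T - E ≤ ν * (∫⁻ τ in Ioo 0 T, eGradNormSq (U τ)).toReal := by
  have hid := hU.energy_eq_zero hT
  have hcont := (continuousOn_work hf hU).mono
    (show uIcc 0 T ⊆ Ici 0 by rw [uIcc_of_le hT]; exact fun τ hτ => hτ.1)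
  have hint : IntervalIntegrable (fun τ => ∫ x, ⟪f x, U τ x⟫_ℝ) volume 0 T := hcont.intervalIntegrable
  have hW : ε₀ * T ≤ ∫ τ in (0 : ℝ)..T, ∫ x, ⟪f x, U τ x⟫_ℝ := by
    have h1 : ∫ _ in (0 : ℝ)..T, ε₀ ≤ ∫ τ in (0 : ℝ)..T, ∫ x, ⟪f x, U τ x⟫_ℝ :=
      intervalIntegral.integral_mono_on hT intervalIntegrable_const hint fun τ hτ => (htrap τ hτ.1).2
    rwa [intervalIntegral.integral_const, smul_eq_mul, sub_zero, mul_comm] at h1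
  have hKE0 : 0 ≤ kineticEnergy (U 0) := Torus.kineticEnergy_nonneg _
  have hKET : kineticEnergy (U T) ≤ E := (htrap T hT).1
  linarith

/-! ## §3 Bernstein and the resolution floor -/

/-- **Bernstein inequality for Galerkin modes** (spectral form): a Galerkin mode `a` of order `N`
has `‖∇a‖² ≤ 8π² N² · kineticEnergy a` in `ℝ≥0∞` (Parseval on the Fourier ball `|k|² ≤ N²`:
`‖∇a‖² = 4π² Σ |k|²‖â k‖² ≤ 4π² N² Σ ‖â k‖² = 4π² N² ∫‖a‖²`). [folklore] -/
theorem eGradNormSq_le_of_isGalerkinMode {a : UnitAddTorus (Fin 3) → EuclideanSpace ℝ (Fin 3)}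
    (ha : IsGalerkinMode N a) :
    eGradNormSq a ≤ ENNReal.ofReal (8 * Real.pi ^ 2 * (N : ℝ) ^ 2 * kineticEnergy a) := by
  have hc : Continuous a := ha.isSmooth.continuous
  have hband : ∀ k : Fin 3 → ℤ, (N : ℝ) ^ 2 < freqNormSq k →
      mFourierCoeff (EuclideanSpace.complexify ∘ a) k = 0 := fun k hk => ha.mFourierCoeff_eq_zero hk
  rw [eGradNormSq_eq_sum_of_band_limited hc hband]
  refine ENNReal.ofReal_le_ofReal ?_
  have hE : kineticEnergy a = 2⁻¹ * ∑ k ∈ freqBall N, ‖mFourierCoeff (EuclideanSpace.complexify ∘ a) k‖ ^ 2 := by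
    rw [kineticEnergy, integral_norm_sq_eq_sum_of_band_limited hc hband]
  rw [hE, Finset.mul_sum, Finset.mul_sum, Finset.mul_sum]
  refine Finset.sum_le_sum fun k hk => ?_
  have hk' : freqNormSq k ≤ (N : ℝ) ^ 2 := mem_freqBall.1 hk
  have h0 : 0 ≤ ‖mFourierCoeff (EuclideanSpace.complexify ∘ a) k‖ ^ 2 := sq_nonneg _
  calc 4 * Real.pi ^ 2 * (freqNormSq k * ‖mFourierCoeff (EuclideanSpace.complexify ∘ a) k‖ ^ 2)
      ≤ 4 * Real.pi ^ 2 * ((N : ℝ) ^ 2 * ‖mFourierCoeff (EuclideanSpace.complexify ∘ a) k‖ ^ 2) := by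
        gcongr
    _ = 8 * Real.pi ^ 2 * (N : ℝ) ^ 2 *
          (2⁻¹ * ‖mFourierCoeff (EuclideanSpace.complexify ∘ a) k‖ ^ 2) := by ring

/-- **Dissipation ceiling at fixed resolution**: along a Galerkin trajectory of order `N` whose
energy stays `≤ E` on `[0, ∞)`, `∫₀ᵀ ‖∇U‖² ≤ 8π² N² E · T` (Bernstein slice by slice). [folklore] -/
theorem lintegral_eGradNormSq_le {E T : ℝ} (hU : Torus.IsGalerkinTrajectory ν f N U)
    (hE : ∀ t : ℝ, 0 ≤ t → kineticEnergy (U t) ≤ E) (hT : 0 ≤ T) :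
    (∫⁻ τ in Ioo 0 T, eGradNormSq (U τ)) ≤ ENNReal.ofReal (8 * Real.pi ^ 2 * (N : ℝ) ^ 2 * E * T) := by
  have hbound : ∀ τ ∈ Ioo 0 T, eGradNormSq (U τ) ≤ ENNReal.ofReal (8 * Real.pi ^ 2 * (N : ℝ) ^ 2 * E) := by
    intro τ hτ
    refine (eGradNormSq_le_of_isGalerkinMode (hU.isGalerkinMode τ hτ.1.le)).trans
      (ENNReal.ofReal_le_ofReal ?_)
    have := hE τ hτ.1.le
    gcongr
  calc (∫⁻ τ in Ioo 0 T, eGradNormSq (U τ))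
      ≤ ∫⁻ _ in Ioo 0 T, ENNReal.ofReal (8 * Real.pi ^ 2 * (N : ℝ) ^ 2 * E) :=
        setLIntegral_mono measurable_const hbound
    _ = ENNReal.ofReal (8 * Real.pi ^ 2 * (N : ℝ) ^ 2 * E) * volume (Ioo 0 T) := setLIntegral_const _ _
    _ = ENNReal.ofReal (8 * Real.pi ^ 2 * (N : ℝ) ^ 2 * E * T) := by
        rw [Real.volume_Ioo, sub_zero, ← ENNReal.ofReal_mul' hT]

/-- **Resolution floor.** A Galerkin trajectory of order `N` at viscosity `ν ≥ 0` (continuous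
force) trapped in `{kineticEnergy ≤ E} ∩ {(f, ·) ≥ ε₀}` for all `t ≥ 0` forces
`ε₀ ≤ 8π² ν N² E`: from `ε₀ T − E ≤ ν∫₀ᵀ‖∇U‖² ≤ 8π² ν N² E T` for all `T ≥ 0`.  Equivalently the
crux's threshold satisfies `N₀(ν) ≥ (ε₀ / (8π² ν E))^{1/2}`: trapping at bounded energy with a
positive work floor is an `N → ∞` phenomenon as `ν → 0`. [folklore] -/
theorem resolution_floor_of_trapped {E ε₀ : ℝ} (hν : 0 ≤ ν) (hf : Continuous f)
    (hU : Torus.IsGalerkinTrajectory ν f N U)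
    (htrap : ∀ t : ℝ, 0 ≤ t → kineticEnergy (U t) ≤ E ∧ ε₀ ≤ ∫ x, ⟪f x, U t x⟫_ℝ) :
    ε₀ ≤ 8 * Real.pi ^ 2 * ν * (N : ℝ) ^ 2 * E := by
  -- `E ≥ 0` (the block is inhabited at `t = 0`)
  have hE0 : 0 ≤ E := (Torus.kineticEnergy_nonneg _).trans (htrap 0 le_rfl).1
  set C : ℝ := 8 * Real.pi ^ 2 * (N : ℝ) ^ 2 * E with hC
  have hC0 : 0 ≤ C := by positivity
  -- for every `T ≥ 0`: `ε₀ T - E ≤ ν C T`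
  have hstep : ∀ T : ℝ, 0 ≤ T → ε₀ * T - E ≤ ν * (C * T) := by
    intro T hT
    have h1 := dissipation_floor_of_trapped hf hU htrap hT
    have h2 : (∫⁻ τ in Ioo 0 T, eGradNormSq (U τ)).toReal ≤ C * T := by
      have h := lintegral_eGradNormSq_le hU (fun t ht => (htrap t ht).1) hT (ν := ν)
      have h' := ENNReal.toReal_mono ENNReal.ofReal_ne_top h
      rwa [ENNReal.toReal_ofReal (mul_nonneg hC0 hT)] at h'
    have h3 : ν * (∫⁻ τ in Ioo 0 T, eGradNormSq (U τ)).toReal ≤ ν * (C * T) :=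
      mul_le_mul_of_nonneg_left h2 hν
    linarith
  -- let `T → ∞`
  by_contra hlt
  push Not at hlt
  have hgap : 0 < ε₀ - ν * C := by rw [hC]; linarith
  set T : ℝ := (E + 1) / (ε₀ - ν * C) with hT
  have hT0 : 0 ≤ T := div_nonneg (by linarith) hgap.le
  have h := hstep T hT0
  have hTeq : (ε₀ - ν * C) * T = E + 1 := by rw [hT]; field_simp
  nlinarith

/-! ## §4 The crux in semiflow language -/

/-- **The crux ⇔ its orbit form.**  `UniformWorkFloorTrap` holds iff there are a mean-zero
Galerkin-mode force `f` of order `m` and `E, ε₀, ν₀ > 0` such that for every `0 < ν ≤ ν₀` there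
is `N₀` with, for every `N ≥ N₀`, a Galerkin mode `a` of order `N` whose forward orbit under the
Galerkin semiflow `Torus.galerkinFlow ν f N` stays in `{kineticEnergy ≤ E} ∩ {(f, ·) ≥ ε₀}` for all
`t ≥ 0`.  (⇒) the clause block of the crux determines the orbit: `U t = galerkinFlow ν f N t (U 0)`
for `t ≥ 0` (its Fourier coefficients solve the Galerkin ODE, `isGalerkinTrajectory_coeff`, so they
are the coefficient-semiflow orbit by uniqueness, `IsGalerkinODESolution.galerkinCoeffFlow_eq`; cf.
`UniformGalerkinTrap.eq_galerkinFlow_of_isGalerkinTrajectory`); (⇐) every forward orbit of a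
Galerkin mode carries the clause block (`IsGalerkinMode.galerkinFlow_clauses`). [folklore] -/
theorem uniformWorkFloorTrap_iff_orbit :
    UniformWorkFloorTrap ↔
      ∃ (m : ℕ) (f : UnitAddTorus (Fin 3) → EuclideanSpace ℝ (Fin 3)),
        IsGalerkinMode m f ∧ HasZeroMean f ∧ ∃ (E ε₀ ν₀ : ℝ), 0 < ε₀ ∧ 0 < ν₀ ∧
          ∀ ν : ℝ, 0 < ν → ν ≤ ν₀ → ∃ N₀ : ℕ, ∀ N : ℕ, N₀ ≤ N →
            ∃ a : UnitAddTorus (Fin 3) → EuclideanSpace ℝ (Fin 3), IsGalerkinMode N a ∧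
              ∀ t : ℝ, 0 ≤ t → kineticEnergy (Torus.galerkinFlow ν f N t a) ≤ E ∧
                ε₀ ≤ ∫ x, ⟪f x, Torus.galerkinFlow ν f N t a x⟫_ℝ := by
  constructor
  · rintro ⟨m, f, hf, hmean, E, ε₀, ν₀, hε₀, hν₀, h⟩
    refine ⟨m, f, hf, hmean, E, ε₀, ν₀, hε₀, hν₀, fun ν hν hνle => ?_⟩
    obtain ⟨N₀, hN⟩ := h ν hν hνle
    refine ⟨N₀, fun N hN₀ => ?_⟩
    obtain ⟨U, hcl, htrap⟩ := hN N hN₀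
    have htraj : Torus.IsGalerkinTrajectory ν f N U := Torus.isGalerkinTrajectory_iff.2 hcl
    have hf2 : MemLp f 2 volume := hf.1.memLp 2
    refine ⟨U 0, htraj.isGalerkinMode 0 le_rfl, fun t ht => ?_⟩
    -- uniqueness: `U t = galerkinFlow ν f N t (U 0)`
    have hcoeff := ((isGalerkinTrajectory_coeff htraj hf2).isGalerkinODESolution).galerkinCoeffFlow_eq ht
    have hUt : U t = Torus.galerkinFlow ν f N t (U 0) := by
      rw [(htraj.isGalerkinMode 0 le_rfl).galerkinFlow_eq t, hcoeff, max_eq_left ht,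
        (htraj.isGalerkinMode t ht).realTrigPoly_fourierRestrict]
    rw [← hUt]
    exact htrap t ht
  · rintro ⟨m, f, hf, hmean, E, ε₀, ν₀, hε₀, hν₀, h⟩
    refine ⟨m, f, hf, hmean, E, ε₀, ν₀, hε₀, hν₀, fun ν hν hνle => ?_⟩
    obtain ⟨N₀, hN⟩ := h ν hν hνle
    refine ⟨N₀, fun N hN₀ => ?_⟩
    obtain ⟨a, ha, hB⟩ := hN N hN₀
    have hf2 : MemLp f 2 volume := hf.isSmooth.memLp 2
    obtain ⟨-, hcont, hslice, htest, henergy⟩ := ha.galerkinFlow_clauses (ν := ν) hν.le hf2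
    exact ⟨fun t => Torus.galerkinFlow ν f N t a, ⟨hcont, fun t ht => hslice t ht,
      fun b hb s t hs hst => htest b hb s t hs hst, henergy⟩, hB⟩

/-! ## §5 Consequences at the level of the crux -/

/-- **The crux implies the family-level dissipation floor** (Galerkin zeroth law, pointwise-floor
form): its witness `(f, E, ε₀, ν₀)` gives, for every `0 < ν ≤ ν₀` and every `N ≥ N₀(ν)`, a global
Galerkin trajectory of order `N` with energy `≤ E` for all times and
`ν ∫₀ᵀ ‖∇U‖² ≥ ε₀ T − E` for every `T ≥ 0` — mean dissipation `≥ ε₀ − E/T`, uniformly in `ν`.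
[folklore] -/
theorem uniformWorkFloorTrap_dissipationFloor (h : UniformWorkFloorTrap) :
    ∃ (m : ℕ) (f : UnitAddTorus (Fin 3) → EuclideanSpace ℝ (Fin 3)),
      IsGalerkinMode m f ∧ HasZeroMean f ∧ ∃ (E ε₀ ν₀ : ℝ), 0 < ε₀ ∧ 0 < ν₀ ∧
        ∀ ν : ℝ, 0 < ν → ν ≤ ν₀ → ∃ N₀ : ℕ, ∀ N : ℕ, N₀ ≤ N →
          ∃ U : ℝ → UnitAddTorus (Fin 3) → EuclideanSpace ℝ (Fin 3),
            Torus.IsGalerkinTrajectory ν f N U ∧ (∀ t : ℝ, 0 ≤ t → kineticEnergy (U t) ≤ E) ∧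
              ∀ T : ℝ, 0 ≤ T → ε₀ * T - E ≤ ν * (∫⁻ τ in Ioo 0 T, eGradNormSq (U τ)).toReal := by
  obtain ⟨m, f, hf, hmean, E, ε₀, ν₀, hε₀, hν₀, h⟩ := h
  refine ⟨m, f, hf, hmean, E, ε₀, ν₀, hε₀, hν₀, fun ν hν hνle => ?_⟩
  obtain ⟨N₀, hN⟩ := h ν hν hνle
  refine ⟨N₀, fun N hN₀ => ?_⟩
  obtain ⟨U, hcl, htrap⟩ := hN N hN₀
  have htraj : Torus.IsGalerkinTrajectory ν f N U := Torus.isGalerkinTrajectory_iff.2 hcl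
  exact ⟨U, htraj, fun t ht => (htrap t ht).1,
    fun T hT => dissipation_floor_of_trapped hf.1.continuous htraj htrap hT⟩

/-- **Natural strengthening refuted: a `ν`-uniform resolution.**  For EVERY force: the crux with
`∃ N₀ ∀ ν ≤ ν₀` in place of `∀ ν ≤ ν₀ ∃ N₀` is FALSE — a trajectory of order `N₀` trapped at
viscosity `ν` needs `ε₀ ≤ 8π² ν N₀² E` (`resolution_floor_of_trapped`), impossible for
`ν < ε₀ / (8π² N₀² E + 1)`. [folklore] -/
theorem not_uniformWorkFloorTrap_fixedResolution :
    ¬ ∃ (m : ℕ) (f : UnitAddTorus (Fin 3) → EuclideanSpace ℝ (Fin 3)),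
      IsGalerkinMode m f ∧ HasZeroMean f ∧ ∃ (E ε₀ ν₀ : ℝ) (N₀ : ℕ), 0 < ε₀ ∧ 0 < ν₀ ∧
        ∀ ν : ℝ, 0 < ν → ν ≤ ν₀ →
          ∃ U : ℝ → UnitAddTorus (Fin 3) → EuclideanSpace ℝ (Fin 3),
            Torus.IsGalerkinTrajectory ν f N₀ U ∧
              ∀ t : ℝ, 0 ≤ t → kineticEnergy (U t) ≤ E ∧ ε₀ ≤ ∫ x, ⟪f x, U t x⟫_ℝ := by
  rintro ⟨m, f, hf, -, E, ε₀, ν₀, N₀, hε₀, hν₀, h⟩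
  set C : ℝ := 8 * Real.pi ^ 2 * (N₀ : ℝ) ^ 2 * |E| + 1 with hC
  have hC0 : 0 < C := by positivity
  -- a viscosity below both `ν₀` and `ε₀ / C`
  set ν : ℝ := min ν₀ (ε₀ / (2 * C)) with hν
  have hνpos : 0 < ν := lt_min hν₀ (div_pos hε₀ (by positivity))
  have hνle : ν ≤ ν₀ := min_le_left _ _
  have hνC : ν ≤ ε₀ / (2 * C) := min_le_right _ _
  obtain ⟨U, hU, htrap⟩ := h ν hνpos hνle
  have hfl := resolution_floor_of_trapped hνpos.le hf.isSmooth.continuous hU htrap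
  -- `8π²N₀²E ≤ C`, so `ε₀ ≤ ν C ≤ ε₀ / 2`
  have hEC : 8 * Real.pi ^ 2 * (N₀ : ℝ) ^ 2 * E ≤ C := by
    have : E ≤ |E| := le_abs_self E
    have h8 : 0 ≤ 8 * Real.pi ^ 2 * (N₀ : ℝ) ^ 2 := by positivity
    nlinarith
  have h1 : ε₀ ≤ ν * C := by
    calc ε₀ ≤ 8 * Real.pi ^ 2 * ν * (N₀ : ℝ) ^ 2 * E := hfl
      _ = ν * (8 * Real.pi ^ 2 * (N₀ : ℝ) ^ 2 * E) := by ring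
      _ ≤ ν * C := mul_le_mul_of_nonneg_left hEC hνpos.le
  have h2 : ν * C ≤ ε₀ / 2 := by
    have := mul_le_mul_of_nonneg_right hνC hC0.le
    rwa [div_mul_eq_mul_div, mul_comm 2 C, ← div_div, mul_div_assoc, div_self hC0.ne', mul_one] at this
  linarith

end Summit.AnomalousDissipation.AnomalousDissipation.Theorems.UniformWorkFloorTrap

end
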